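import Summits.AtomisticToContinuum.HydrodynamicLimit.Theorems.TwoClocksEquilibriumFastWindowLDBirthCollisionFrequencyUpper
import HarnessLib

/-!
# Large-speed asymptotics of the partner-loss term `K₁` of the linearised hard-sphere operator of `ℝ³`
# (helpers `t12_lossTerm_asymptotics`, `t12_lossTerm_le_of_memLp` of the line `birth`,
# crux `TwoClocks.EquilibriumFastWindowLD`, stmt-AtomisticToContinuum-14440; infrastructure (e-K₁) of the
# analytic residue `t12_logLinearPreimage_and_dipoleModulus` of `stub_correctorTransfer`)

Grad's splitting of the linearised hard-sphere operator around the normalised Maxwellian `M` of `ℝ³`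
(`M dv = stdGaussian`, `Literature.Analysis.UnboundedOperators.hardSphereLinearizedOp`, CIP 1994 §7.2) is
`L = K₂ - K₁ - ν` (`kernelAction_eq_pieces_of_gaussGrowth`, `hardSphereLinearizedOp_eq_kernel_sub_of_gaussGrowth`),
with the **partner-loss term**

  `K₁u(v) := ∫ (∫_{S²} ((v - w)·ω)₊ dσ(ω)) u(w) dM(w) = π ∫ |v - w| u(w) dM(w)`

(tree form `∫ w, ∫ ω, hardSphereKernel (v, w) ω * u w ∂sphereMeasure ∂stdGaussian _`; the angular integral
is `π |v - w|` by the hat-box theorem `sphereIntegral_hardSphereKernel_zero`; `lossTerm_eq_pi_mul_integral`).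
This file records its large-speed behaviour, the input (e-K₁) of the sector-by-sector (`ℓ = 0, 1`) radial
analysis of the corrector: `K₁` only sees the mass and the first moment of `u`, up to `O(1/|v|)`.

* `abs_norm_mul_norm_sub_sub_le` — the elementary two-sided tangent bound of the Euclidean norm
  **`0 ≤ |v| |v - w| - (|v|² - v·w) ≤ |w|²/2`**, i.e. `| |v - w| - |v| + v̂·w | ≤ |w|²/(2|v|)`
  (lower: Cauchy–Schwarz `⟪v, v - w⟫ ≤ |v| |v - w|`; upper: `norm_mul_norm_sub_le` of the sibling file);
* `norm_mul_lossTerm_sub_le` — for `u, |w|² u ∈ L¹(M)` and EVERY `v` (no side condition),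
  **`| |v| K₁u(v) - π (|v|² ∫ u dM - ∫ u(w) ⟪w, v⟫ dM(w)) | ≤ (π/2) ∫ |w|² |u(w)| dM(w)`**;
* `t12_lossTerm_asymptotics` (registered) — the divided form for `v ≠ 0`:
  **`| K₁u(v) - π (|v| ∫ u dM - |v|⁻¹ ∫ u(w) ⟪w, v⟫ dM(w)) | ≤ π/(2|v|) ∫ |w|² |u| dM`**; the dipole term is
  the scalar `∫ u(w) ⟪w, v⟫ dM(w)`, definitionally `maxwellianInner u (fun w => ⟪w, v⟫)`, so that it drops out
  verbatim for `u ⊥_M` the linear collision invariants `w ↦ ⟪w, e⟫`, as does the mass term for `u ⊥_M 1`: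
* `abs_lossTerm_le_of_moments_eq_zero`, `abs_lossTerm_le_of_orthogonal` (`u ⊥_M collisionInvariants`) — then
  **`|K₁u(v)| ≤ π/(2|v|) ∫ |w|² |u| dM`**, DECAYING in `|v|`;
* `t12_lossTerm_le_of_memLp` (registered) — the Cauchy–Schwarz form for `u ∈ L²(M)` and every `v`:
  **`|K₁u(v)| ≤ π √(|v|² + 3) ‖u‖_{L²(M)}`** (`∫ |v - w|² dM = |v|² + 3`), with its linear shape
  `≤ π (|v| + 2) ‖u‖_{L²(M)}` (`abs_lossTerm_le_linear_of_memLp`);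
* `integral_norm_sq_mul_abs_le_of_memLp` — `∫ |w|² |u| dM ≤ √15 ‖u‖_{L²(M)}` (`∫ |w|⁴ dM = 15`), whence the
  `L²(M)` size `π √15 / (2|v|) ‖u‖_{L²(M)}` of the remainder (`lossTerm_asymptotics_of_memLp`,
  `abs_lossTerm_le_of_memLp_of_moments_eq_zero`, `abs_lossTerm_le_of_memLp_of_orthogonal`), and `|w|² u ∈ L¹(M)`
  for `u ∈ L²(M)` (`integrable_norm_sq_mul_of_memLp`): the `L¹` hypotheses above are met by `L²(M)` functions.

All integrals are Bochner integrals against `stdGaussian (EuclideanSpace ℝ (Fin 3))`; `‖u‖_{L²(M)}` is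
`(eLpNorm u 2 (stdGaussian _)).toReal` as elsewhere in the tree. No new definitions. References:
Cercignani–Illner–Pulvirenti 1994 §7.2 (Grad's splitting `L = K - ν`, (2.10)–(2.15)); Grad 1963 §4. [folklore]
-/

noncomputable section

open MeasureTheory ProbabilityTheory Real Set Filter
open scoped ENNReal BigOperators InnerProductSpace

namespace Summit.AtomisticToContinuum.HydrodynamicLimit.Theorems.ClampedCorrectorBirth

open Literature.Analysis.FluidPDE Literature.MathematicalPhysics.KineticTheory
open Literature.Analysis.UnboundedOperators Literature.Probability.Distributions

/-! ### The loss term is `π ∫ |v - w| u(w) dM(w)`; the elementary tangent bound -/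

/-- `K₁u(v) = π ∫ |v - w| u(w) dM(w)`: the angular integral of the hard-sphere kernel is
`∫ ((v - w)·ω)₊ dσ(ω) = π |v - w|` (hat-box theorem). No integrability is needed (both sides junk together). -/
theorem lossTerm_eq_pi_mul_integral (u : EuclideanSpace ℝ (Fin 3) → ℝ) (v : EuclideanSpace ℝ (Fin 3)) :
    ∫ w, ∫ ω, hardSphereKernel (v, w) ω * u w ∂sphereMeasure ∂stdGaussian (EuclideanSpace ℝ (Fin 3)) =
      Real.pi * ∫ w, ‖v - w‖ * u w ∂stdGaussian (EuclideanSpace ℝ (Fin 3)) := by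
  rw [← integral_const_mul]
  refine integral_congr_ae (Eventually.of_forall fun w => ?_)
  change ∫ ω, hardSphereKernel (v, w) ω * u w ∂sphereMeasure = Real.pi * (‖v - w‖ * u w)
  rw [integral_mul_const, integral_congr_ae (Eventually.of_forall fun ω => hardSphereKernel_eq_sub_zero v w ω),
    sphereIntegral_hardSphereKernel_zero (v - w), mul_assoc]

/-- Cauchy–Schwarz side of the tangent bound: `|v|² - v·w = ⟪v, v - w⟫ ≤ |v| |v - w|`. -/
theorem norm_sq_sub_inner_le_norm_mul_norm_sub (v w : EuclideanSpace ℝ (Fin 3)) :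
    ‖v‖ ^ 2 - ⟪v, w⟫_ℝ ≤ ‖v‖ * ‖v - w‖ := by
  have h : ⟪v, v - w⟫_ℝ ≤ ‖v‖ * ‖v - w‖ := real_inner_le_norm v (v - w)
  rwa [inner_sub_right, real_inner_self_eq_norm_sq] at h

/-- **The two-sided tangent bound of the Euclidean norm at `|v|²`**:
`| |v| |v - w| - (|v|² - v·w) | ≤ |w|²/2`, i.e. for `v ≠ 0`, `| |v - w| - |v| + v̂·w | ≤ |w|²/(2|v|)`
(in fact `0 ≤ |v| |v - w| - (|v|² - v·w) ≤ |w|²/2`). [folklore] -/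
theorem abs_norm_mul_norm_sub_sub_le (v w : EuclideanSpace ℝ (Fin 3)) :
    |‖v‖ * ‖v - w‖ - (‖v‖ ^ 2 - ⟪v, w⟫_ℝ)| ≤ ‖w‖ ^ 2 / 2 := by
  rw [abs_le]
  refine ⟨?_, by linarith [norm_mul_norm_sub_le v w]⟩
  have h := norm_sq_sub_inner_le_norm_mul_norm_sub v w
  nlinarith [sq_nonneg ‖w‖]

/-! ### Integrability bookkeeping under `u, |w|² u ∈ L¹(M)` -/

/-- `|w| u ∈ L¹(M)` when `u, |w|² u ∈ L¹(M)` (`|w| ≤ 1 + |w|²`). -/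
theorem integrable_norm_mul_of_integrable_norm_sq_mul {u : EuclideanSpace ℝ (Fin 3) → ℝ}
    (hu : Integrable u (stdGaussian (EuclideanSpace ℝ (Fin 3))))
    (hu2 : Integrable (fun w => ‖w‖ ^ 2 * u w) (stdGaussian (EuclideanSpace ℝ (Fin 3)))) :
    Integrable (fun w => ‖w‖ * u w) (stdGaussian (EuclideanSpace ℝ (Fin 3))) := by
  refine (hu.norm.add hu2.norm).mono' (continuous_norm.aestronglyMeasurable.mul hu.aestronglyMeasurable)
    (Eventually.of_forall fun w => ?_)
  simp only [Pi.add_apply, Real.norm_eq_abs, abs_mul, abs_pow, abs_norm]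
  nlinarith [mul_nonneg (sq_nonneg (‖w‖ - 1)) (abs_nonneg (u w)), mul_nonneg (norm_nonneg w) (abs_nonneg (u w))]

/-- `u(w) ⟪w, v⟫ ∈ L¹(M)` when `u, |w|² u ∈ L¹(M)`. -/
theorem integrable_mul_inner_of_integrable_norm_sq_mul {u : EuclideanSpace ℝ (Fin 3) → ℝ}
    (hu : Integrable u (stdGaussian (EuclideanSpace ℝ (Fin 3))))
    (hu2 : Integrable (fun w => ‖w‖ ^ 2 * u w) (stdGaussian (EuclideanSpace ℝ (Fin 3))))
    (v : EuclideanSpace ℝ (Fin 3)) :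
    Integrable (fun w => u w * ⟪w, v⟫_ℝ) (stdGaussian (EuclideanSpace ℝ (Fin 3))) := by
  refine ((integrable_norm_mul_of_integrable_norm_sq_mul hu hu2).norm.const_mul ‖v‖).mono'
    (hu.aestronglyMeasurable.mul (Continuous.aestronglyMeasurable (by fun_prop)))
    (Eventually.of_forall fun w => ?_)
  simp only [Real.norm_eq_abs, abs_mul, abs_norm]
  calc |u w| * |⟪w, v⟫_ℝ| ≤ |u w| * (‖w‖ * ‖v‖) :=
        mul_le_mul_of_nonneg_left (abs_real_inner_le_norm w v) (abs_nonneg _)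
    _ = ‖v‖ * (‖w‖ * |u w|) := by ring

/-- `|v - w| u(w) ∈ L¹(M)` when `u, |w|² u ∈ L¹(M)`. -/
theorem integrable_norm_sub_mul_of_integrable_norm_sq_mul {u : EuclideanSpace ℝ (Fin 3) → ℝ}
    (hu : Integrable u (stdGaussian (EuclideanSpace ℝ (Fin 3))))
    (hu2 : Integrable (fun w => ‖w‖ ^ 2 * u w) (stdGaussian (EuclideanSpace ℝ (Fin 3))))
    (v : EuclideanSpace ℝ (Fin 3)) :
    Integrable (fun w => ‖v - w‖ * u w) (stdGaussian (EuclideanSpace ℝ (Fin 3))) := by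
  refine ((hu.norm.const_mul ‖v‖).add (integrable_norm_mul_of_integrable_norm_sq_mul hu hu2).norm).mono'
    ((continuous_const.sub continuous_id).norm.aestronglyMeasurable.mul hu.aestronglyMeasurable)
    (Eventually.of_forall fun w => ?_)
  simp only [Pi.add_apply, Real.norm_eq_abs, abs_mul, abs_norm]
  calc ‖v - w‖ * |u w| ≤ (‖v‖ + ‖w‖) * |u w| := mul_le_mul_of_nonneg_right (norm_sub_le v w) (abs_nonneg _)
    _ = ‖v‖ * |u w| + ‖w‖ * |u w| := by ring

/-! ### The asymptotics of the loss term -/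

/-- **Large-speed asymptotics of the partner-loss term, multiplied form (every `v`).** For
`u, |w|² u ∈ L¹(M)`:
`| |v| K₁u(v) - π (|v|² ∫ u dM - ∫ u(w) ⟪w, v⟫ dM(w)) | ≤ (π/2) ∫ |w|² |u(w)| dM(w)`.
Proof: `K₁u(v) = π ∫ |v - w| u dM` and `0 ≤ |v| |v - w| - (|v|² - v·w) ≤ |w|²/2` pointwise. [folklore] -/
theorem norm_mul_lossTerm_sub_le {u : EuclideanSpace ℝ (Fin 3) → ℝ}
    (hu : Integrable u (stdGaussian (EuclideanSpace ℝ (Fin 3))))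
    (hu2 : Integrable (fun w => ‖w‖ ^ 2 * u w) (stdGaussian (EuclideanSpace ℝ (Fin 3))))
    (v : EuclideanSpace ℝ (Fin 3)) :
    |‖v‖ * (∫ w, ∫ ω, hardSphereKernel (v, w) ω * u w ∂sphereMeasure ∂stdGaussian (EuclideanSpace ℝ (Fin 3))) -
        Real.pi * (‖v‖ ^ 2 * ∫ w, u w ∂stdGaussian (EuclideanSpace ℝ (Fin 3)) -
          ∫ w, u w * ⟪w, v⟫_ℝ ∂stdGaussian (EuclideanSpace ℝ (Fin 3)))| ≤
      Real.pi / 2 * ∫ w, ‖w‖ ^ 2 * |u w| ∂stdGaussian (EuclideanSpace ℝ (Fin 3)) := by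
  have h1 := integrable_norm_sub_mul_of_integrable_norm_sq_mul hu hu2 v
  have h3 := integrable_mul_inner_of_integrable_norm_sq_mul hu hu2 v
  -- the remainder kernel `r(w) = |v| |v - w| - (|v|² - v·w) ∈ [0, |w|²/2]`
  set r : EuclideanSpace ℝ (Fin 3) → ℝ := fun w => ‖v‖ * ‖v - w‖ - (‖v‖ ^ 2 - ⟪v, w⟫_ℝ) with hr
  have hkey :
      ‖v‖ * (∫ w, ∫ ω, hardSphereKernel (v, w) ω * u w ∂sphereMeasure ∂stdGaussian (EuclideanSpace ℝ (Fin 3))) -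
      Real.pi * (‖v‖ ^ 2 * ∫ w, u w ∂stdGaussian (EuclideanSpace ℝ (Fin 3)) -
        ∫ w, u w * ⟪w, v⟫_ℝ ∂stdGaussian (EuclideanSpace ℝ (Fin 3))) =
        Real.pi * ∫ w, r w * u w ∂stdGaussian (EuclideanSpace ℝ (Fin 3)) := by
    have hpt : ∀ w, r w * u w = ‖v‖ * (‖v - w‖ * u w) - (‖v‖ ^ 2 * u w - u w * ⟪w, v⟫_ℝ) := by
      intro w
      show (‖v‖ * ‖v - w‖ - (‖v‖ ^ 2 - ⟪v, w⟫_ℝ)) * u w = _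
      rw [real_inner_comm w v]
      ring
    have hB : Integrable (fun w => ‖v‖ ^ 2 * u w - u w * ⟪w, v⟫_ℝ) (stdGaussian (EuclideanSpace ℝ (Fin 3))) :=
      (hu.const_mul _).sub h3
    have hA : Integrable (fun w => ‖v‖ * (‖v - w‖ * u w)) (stdGaussian (EuclideanSpace ℝ (Fin 3))) := h1.const_mul _
    have hsplit : ∫ w, r w * u w ∂stdGaussian (EuclideanSpace ℝ (Fin 3)) =
        ‖v‖ * ∫ w, ‖v - w‖ * u w ∂stdGaussian (EuclideanSpace ℝ (Fin 3)) -
          (‖v‖ ^ 2 * ∫ w, u w ∂stdGaussian (EuclideanSpace ℝ (Fin 3)) -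
            ∫ w, u w * ⟪w, v⟫_ℝ ∂stdGaussian (EuclideanSpace ℝ (Fin 3))) := by
      simp_rw [hpt]
      rw [integral_sub hA hB, integral_sub (hu.const_mul _) h3, integral_const_mul, integral_const_mul]
    rw [lossTerm_eq_pi_mul_integral, hsplit]
    ring
  have hg : Integrable (fun w => ‖w‖ ^ 2 * |u w| / 2) (stdGaussian (EuclideanSpace ℝ (Fin 3))) := by
    refine (hu2.norm.div_const 2).congr (Eventually.of_forall fun w => ?_)
    show ‖‖w‖ ^ 2 * u w‖ / 2 = ‖w‖ ^ 2 * |u w| / 2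
    rw [Real.norm_eq_abs, abs_mul, abs_pow, abs_norm]
  have hbound : |∫ w, r w * u w ∂stdGaussian (EuclideanSpace ℝ (Fin 3))| ≤
      (∫ w, ‖w‖ ^ 2 * |u w| ∂stdGaussian (EuclideanSpace ℝ (Fin 3))) / 2 := by
    rw [← integral_div, ← Real.norm_eq_abs]
    refine norm_integral_le_of_norm_le hg (Eventually.of_forall fun w => ?_)
    rw [Real.norm_eq_abs, abs_mul, mul_div_right_comm]
    exact mul_le_mul_of_nonneg_right (abs_norm_mul_norm_sub_sub_le v w) (abs_nonneg _)
  rw [hkey, abs_mul, abs_of_pos Real.pi_pos]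
  calc Real.pi * |∫ w, r w * u w ∂stdGaussian (EuclideanSpace ℝ (Fin 3))|
      ≤ Real.pi * ((∫ w, ‖w‖ ^ 2 * |u w| ∂stdGaussian (EuclideanSpace ℝ (Fin 3))) / 2) :=
        mul_le_mul_of_nonneg_left hbound Real.pi_pos.le
    _ = Real.pi / 2 * ∫ w, ‖w‖ ^ 2 * |u w| ∂stdGaussian (EuclideanSpace ℝ (Fin 3)) := by ring

/-- **Large-speed asymptotics of the partner-loss term `K₁` of Grad's splitting (`ℝ³`; registered helper
`t12_lossTerm_asymptotics`).** For `u, |w|² u ∈ L¹(M)` and `v ≠ 0`: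
`| K₁u(v) - π (|v| ∫ u dM - |v|⁻¹ ∫ u(w) ⟪w, v⟫ dM(w)) | ≤ π/(2|v|) ∫ |w|² |u(w)| dM(w)`,
i.e. `K₁u(v) = π |v| ⟨u⟩_M - π ⟪v̂, ∫ w u dM⟫ + O(|v|⁻¹)`: at large speed the loss term only sees the mass
and the first moment of `u` (the dipole term is `maxwellianInner u (fun w => ⟪w, v⟫)` by `rfl`).
From `| |v - w| - |v| + v̂·w | ≤ |w|²/(2|v|)` (`abs_norm_mul_norm_sub_sub_le`). CIP 1994 §7.2; Grad 1963 §4.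
[folklore] -/
theorem t12_lossTerm_asymptotics : ∀ u : EuclideanSpace ℝ (Fin 3) → ℝ, MeasureTheory.Integrable u (ProbabilityTheory.stdGaussian (EuclideanSpace ℝ (Fin 3))) → MeasureTheory.Integrable (fun w => ‖w‖ ^ 2 * u w) (ProbabilityTheory.stdGaussian (EuclideanSpace ℝ (Fin 3))) → ∀ v : EuclideanSpace ℝ (Fin 3), v ≠ 0 → |(∫ w, ∫ ω, Literature.MathematicalPhysics.KineticTheory.hardSphereKernel (v, w) ω * u w ∂Literature.MathematicalPhysics.KineticTheory.sphereMeasure ∂ProbabilityTheory.stdGaussian (EuclideanSpace ℝ (Fin 3))) - Real.pi * (‖v‖ * ∫ w, u w ∂ProbabilityTheory.stdGaussian (EuclideanSpace ℝ (Fin 3)) - ‖v‖⁻¹ * ∫ w, u w * inner ℝ w v ∂ProbabilityTheory.stdGaussian (EuclideanSpace ℝ (Fin 3)))| ≤ Real.pi / (2 * ‖v‖) * ∫ w, ‖w‖ ^ 2 * |u w| ∂ProbabilityTheory.stdGaussian (EuclideanSpace ℝ (Fin 3)) := by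
  intro u hu hu2 v hv
  have hvn : 0 < ‖v‖ := norm_pos_iff.2 hv
  have key := norm_mul_lossTerm_sub_le hu hu2 v
  set K := ∫ w, ∫ ω, hardSphereKernel (v, w) ω * u w ∂sphereMeasure ∂stdGaussian (EuclideanSpace ℝ (Fin 3)) with hK
  set A := ∫ w, u w ∂stdGaussian (EuclideanSpace ℝ (Fin 3)) with hA
  set D := ∫ w, u w * ⟪w, v⟫_ℝ ∂stdGaussian (EuclideanSpace ℝ (Fin 3)) with hD
  set Y := ∫ w, ‖w‖ ^ 2 * |u w| ∂stdGaussian (EuclideanSpace ℝ (Fin 3)) with hY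
  have hinv : ‖v‖⁻¹ * ‖v‖ = 1 := inv_mul_cancel₀ hvn.ne'
  have heq : K - Real.pi * (‖v‖ * A - ‖v‖⁻¹ * D) = ‖v‖⁻¹ * (‖v‖ * K - Real.pi * (‖v‖ ^ 2 * A - D)) := by
    linear_combination (Real.pi * ‖v‖ * A - K) * hinv
  rw [heq, abs_mul, abs_of_pos (inv_pos.2 hvn)]
  calc ‖v‖⁻¹ * |‖v‖ * K - Real.pi * (‖v‖ ^ 2 * A - D)| ≤ ‖v‖⁻¹ * (Real.pi / 2 * Y) :=
        mul_le_mul_of_nonneg_left key (inv_pos.2 hvn).le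
    _ = Real.pi / (2 * ‖v‖) * Y := by ring

/-- **Decay of the loss term on functions without mass and first moment along `v`.** If
`u, |w|² u ∈ L¹(M)`, `∫ u dM = 0` and `∫ u(w) ⟪w, v⟫ dM(w) = 0` (e.g. `u ⊥_M` the collision invariants
`1` and `w ↦ ⟪w, v⟫`), then `|K₁u(v)| ≤ π/(2|v|) ∫ |w|² |u| dM` — the loss term DECAYS at large speed.
[folklore] -/
theorem abs_lossTerm_le_of_moments_eq_zero {u : EuclideanSpace ℝ (Fin 3) → ℝ}
    (hu : Integrable u (stdGaussian (EuclideanSpace ℝ (Fin 3))))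
    (hu2 : Integrable (fun w => ‖w‖ ^ 2 * u w) (stdGaussian (EuclideanSpace ℝ (Fin 3))))
    {v : EuclideanSpace ℝ (Fin 3)} (hv : v ≠ 0) (h0 : ∫ w, u w ∂stdGaussian (EuclideanSpace ℝ (Fin 3)) = 0)
    (h1 : ∫ w, u w * ⟪w, v⟫_ℝ ∂stdGaussian (EuclideanSpace ℝ (Fin 3)) = 0) :
    |∫ w, ∫ ω, hardSphereKernel (v, w) ω * u w ∂sphereMeasure ∂stdGaussian (EuclideanSpace ℝ (Fin 3))| ≤
      Real.pi / (2 * ‖v‖) * ∫ w, ‖w‖ ^ 2 * |u w| ∂stdGaussian (EuclideanSpace ℝ (Fin 3)) := by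
  have h := t12_lossTerm_asymptotics u hu hu2 v hv
  rwa [h0, h1, mul_zero, mul_zero, sub_zero, mul_zero, sub_zero] at h

/-- The decay bound for `u ⊥_M` the collision invariants (the form in which the sectors `ℓ ≥ 1` of the
corrector meet it): if `u, |w|² u ∈ L¹(M)` and `maxwellianInner u φ = 0` for every `φ ∈ span{1, v_j, |v|²}`,
then `|K₁u(v)| ≤ π/(2|v|) ∫ |w|² |u| dM` for `v ≠ 0` (only `φ = 1` and `φ = ⟪·, v⟫` are used). [folklore] -/
theorem abs_lossTerm_le_of_orthogonal {u : EuclideanSpace ℝ (Fin 3) → ℝ}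
    (hu : Integrable u (stdGaussian (EuclideanSpace ℝ (Fin 3))))
    (hu2 : Integrable (fun w => ‖w‖ ^ 2 * u w) (stdGaussian (EuclideanSpace ℝ (Fin 3))))
    (horth : ∀ φ ∈ collisionInvariants (EuclideanSpace ℝ (Fin 3)), maxwellianInner u φ = 0)
    {v : EuclideanSpace ℝ (Fin 3)} (hv : v ≠ 0) :
    |∫ w, ∫ ω, hardSphereKernel (v, w) ω * u w ∂sphereMeasure ∂stdGaussian (EuclideanSpace ℝ (Fin 3))| ≤
      Real.pi / (2 * ‖v‖) * ∫ w, ‖w‖ ^ 2 * |u w| ∂stdGaussian (EuclideanSpace ℝ (Fin 3)) := by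
  refine abs_lossTerm_le_of_moments_eq_zero hu hu2 hv ?_ ?_
  · have h := horth (fun _ => (1 : ℝ)) (Submodule.subset_span (Or.inl (Or.inl rfl)))
    simpa only [maxwellianInner, mul_one] using h
  · have h := horth (fun w => ⟪w, v⟫_ℝ) (Submodule.subset_span (Or.inr ⟨v, rfl⟩))
    simpa only [maxwellianInner] using h

/-! ### The `L²(M)` forms (Cauchy–Schwarz) -/

/-- Cauchy–Schwarz in `L²(M)` in the tree's currency: `∫ f |u| dM ≤ √(∫ f² dM) ‖u‖_{L²(M)}` for `f ≥ 0`,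
`f, u ∈ L²(M)`. [folklore] -/
theorem integral_mul_abs_le_sqrt_mul_eLpNorm {f u : EuclideanSpace ℝ (Fin 3) → ℝ} (hf0 : ∀ w, 0 ≤ f w)
    (hf : MemLp f 2 (stdGaussian (EuclideanSpace ℝ (Fin 3)))) (hu : MemLp u 2 (stdGaussian (EuclideanSpace ℝ (Fin 3)))) :
    ∫ w, f w * |u w| ∂stdGaussian (EuclideanSpace ℝ (Fin 3)) ≤
      Real.sqrt (∫ w, f w ^ 2 ∂stdGaussian (EuclideanSpace ℝ (Fin 3))) *
        (eLpNorm u 2 (stdGaussian (EuclideanSpace ℝ (Fin 3)))).toReal := by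
  have h2 : ENNReal.ofReal (2 : ℝ) = 2 := by simp
  have hua : MemLp (fun w => |u w|) 2 (stdGaussian (EuclideanSpace ℝ (Fin 3))) := hu.abs
  have hH := integral_mul_le_Lp_mul_Lq_of_nonneg (μ := stdGaussian (EuclideanSpace ℝ (Fin 3)))
    Real.HolderConjugate.two_two (ae_of_all _ hf0) (ae_of_all _ fun w => abs_nonneg (u w))
    (by rw [h2]; exact hf) (by rw [h2]; exact hua)
  simp only [Real.rpow_two] at hH
  rw [← Real.sqrt_eq_rpow, ← Real.sqrt_eq_rpow] at hH
  refine hH.trans (le_of_eq ?_)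
  congr 1
  rw [hu.eLpNorm_eq_integral_rpow_norm (by norm_num) ENNReal.ofNat_ne_top, ENNReal.toReal_ofReal (by positivity),
    Real.sqrt_eq_rpow]
  congr 1
  · refine integral_congr_ae (Eventually.of_forall fun w => ?_)
    simp only [ENNReal.toReal_ofNat, Real.norm_eq_abs, Real.rpow_two, sq_abs]
  · norm_num

/-- `|w|²` is in `L²(M)` and `∫ (|w|²)² dM = 15` (`∫ |w|⁴ dγ = d (d + 2)`, `d = 3`). -/
theorem memLp_two_norm_sq_and_integral :
    MemLp (fun w : EuclideanSpace ℝ (Fin 3) => ‖w‖ ^ 2) 2 (stdGaussian (EuclideanSpace ℝ (Fin 3))) ∧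
      ∫ w, (‖w‖ ^ 2) ^ 2 ∂stdGaussian (EuclideanSpace ℝ (Fin 3)) = 15 := by
  have h := (IsGaussian.memLp_id (stdGaussian (EuclideanSpace ℝ (Fin 3))) 4 (by simp)).integrable_norm_pow
    (by norm_num)
  have hpt : ∀ w : EuclideanSpace ℝ (Fin 3), (‖w‖ ^ 2) ^ 2 = ‖w‖ ^ 4 := fun w => by ring
  refine ⟨?_, ?_⟩
  · rw [memLp_two_iff_integrable_sq (by fun_prop)]
    refine h.congr (Eventually.of_forall fun w => ?_)
    simp only [id, hpt]
  · simp_rw [hpt]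
    rw [integral_norm_pow_four_stdGaussian (EuclideanSpace.basisFun (Fin 3) ℝ), Fintype.card_fin]
    norm_num

/-- `|w|² u ∈ L¹(M)` for `u ∈ L²(M)` (`|w|² ∈ L²(M)` and Cauchy–Schwarz). -/
theorem integrable_norm_sq_mul_of_memLp {u : EuclideanSpace ℝ (Fin 3) → ℝ}
    (hu : MemLp u 2 (stdGaussian (EuclideanSpace ℝ (Fin 3)))) :
    Integrable (fun w => ‖w‖ ^ 2 * u w) (stdGaussian (EuclideanSpace ℝ (Fin 3))) :=
  memLp_two_norm_sq_and_integral.1.integrable_mul hu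

/-- **`∫ |w|² |u(w)| dM(w) ≤ √15 ‖u‖_{L²(M)}`** for `u ∈ L²(M)` (Cauchy–Schwarz, `∫ |w|⁴ dM = 15`): the
`L²(M)` size of the remainder of `t12_lossTerm_asymptotics`. [folklore] -/
theorem integral_norm_sq_mul_abs_le_of_memLp {u : EuclideanSpace ℝ (Fin 3) → ℝ}
    (hu : MemLp u 2 (stdGaussian (EuclideanSpace ℝ (Fin 3)))) :
    ∫ w, ‖w‖ ^ 2 * |u w| ∂stdGaussian (EuclideanSpace ℝ (Fin 3)) ≤
      Real.sqrt 15 * (eLpNorm u 2 (stdGaussian (EuclideanSpace ℝ (Fin 3)))).toReal := by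
  obtain ⟨h4, h15⟩ := memLp_two_norm_sq_and_integral
  have h := integral_mul_abs_le_sqrt_mul_eLpNorm (fun w => sq_nonneg ‖w‖) h4 hu
  rwa [h15] at h

/-- `∫ |v - w|² dM(w) = |v|² + 3` (`∫ w dM = 0`, `∫ |w|² dM = 3`). -/
theorem integral_norm_sub_sq_stdGaussian (v : EuclideanSpace ℝ (Fin 3)) :
    ∫ w, ‖v - w‖ ^ 2 ∂stdGaussian (EuclideanSpace ℝ (Fin 3)) = ‖v‖ ^ 2 + 3 := by
  have hid : Integrable (fun w : EuclideanSpace ℝ (Fin 3) => w) (stdGaussian (EuclideanSpace ℝ (Fin 3))) :=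
    (IsGaussian.memLp_id (stdGaussian (EuclideanSpace ℝ (Fin 3))) 1 ENNReal.one_ne_top).integrable le_rfl
  have hinner : Integrable (fun w : EuclideanSpace ℝ (Fin 3) => ⟪v, w⟫_ℝ) (stdGaussian (EuclideanSpace ℝ (Fin 3))) :=
    hid.const_inner v
  have hsq : Integrable (fun w : EuclideanSpace ℝ (Fin 3) => ‖w‖ ^ 2) (stdGaussian (EuclideanSpace ℝ (Fin 3))) :=
    (IsGaussian.memLp_id (stdGaussian (EuclideanSpace ℝ (Fin 3))) 2 (by simp)).integrable_norm_pow (by norm_num)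
  have hI0 : ∫ w, ⟪v, w⟫_ℝ ∂stdGaussian (EuclideanSpace ℝ (Fin 3)) = 0 := by
    rw [integral_inner hid, integral_id_stdGaussian, inner_zero_right]
  have hI2 : ∫ w : EuclideanSpace ℝ (Fin 3), ‖w‖ ^ 2 ∂stdGaussian (EuclideanSpace ℝ (Fin 3)) = 3 := by
    rw [integral_norm_sq_stdGaussian (EuclideanSpace.basisFun (Fin 3) ℝ), Fintype.card_fin]
    norm_num
  have hA : Integrable (fun w : EuclideanSpace ℝ (Fin 3) => ‖v‖ ^ 2 - 2 * ⟪v, w⟫_ℝ)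
      (stdGaussian (EuclideanSpace ℝ (Fin 3))) :=
    (integrable_const _).sub (hinner.const_mul 2)
  simp_rw [norm_sub_sq_real]
  rw [integral_add hA hsq, integral_sub (integrable_const _) (hinner.const_mul 2), integral_const,
    probReal_univ, one_smul, integral_const_mul, hI0, hI2]
  ring

/-- `w ↦ |v - w|` is in `L²(M)`. -/
theorem memLp_two_norm_sub (v : EuclideanSpace ℝ (Fin 3)) :
    MemLp (fun w : EuclideanSpace ℝ (Fin 3) => ‖v - w‖) 2 (stdGaussian (EuclideanSpace ℝ (Fin 3))) :=
  ((memLp_const v).sub (IsGaussian.memLp_id (stdGaussian (EuclideanSpace ℝ (Fin 3))) 2 (by simp))).norm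

/-- **The partner-loss term of an `L²(M)` function grows at most linearly (`ℝ³`; registered helper
`t12_lossTerm_le_of_memLp`):** `|K₁u(v)| ≤ π √(|v|² + 3) ‖u‖_{L²(M)}` for every `v`
(`K₁u(v) = π ∫ |v - w| u dM`, Cauchy–Schwarz, `∫ |v - w|² dM = |v|² + 3`). Sharp-constant form of the
tree's `lintegral_loss_enorm_le`; CIP 1994 §7.2 (2.15). [folklore] -/
theorem t12_lossTerm_le_of_memLp : ∀ u : EuclideanSpace ℝ (Fin 3) → ℝ, MeasureTheory.MemLp u 2 (ProbabilityTheory.stdGaussian (EuclideanSpace ℝ (Fin 3))) → ∀ v : EuclideanSpace ℝ (Fin 3), |∫ w, ∫ ω, Literature.MathematicalPhysics.KineticTheory.hardSphereKernel (v, w) ω * u w ∂Literature.MathematicalPhysics.KineticTheory.sphereMeasure ∂ProbabilityTheory.stdGaussian (EuclideanSpace ℝ (Fin 3))| ≤ Real.pi * Real.sqrt (‖v‖ ^ 2 + 3) * (MeasureTheory.eLpNorm u 2 (ProbabilityTheory.stdGaussian (EuclideanSpace ℝ (Fin 3)))).toReal := by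
  intro u hu v
  have hui : Integrable u (stdGaussian (EuclideanSpace ℝ (Fin 3))) := hu.integrable one_le_two
  have hu2 := integrable_norm_sq_mul_of_memLp hu
  have h1 := integrable_norm_sub_mul_of_integrable_norm_sq_mul hui hu2 v
  rw [lossTerm_eq_pi_mul_integral, abs_mul, abs_of_pos Real.pi_pos, mul_assoc]
  refine mul_le_mul_of_nonneg_left ?_ Real.pi_pos.le
  have hb : |∫ w, ‖v - w‖ * u w ∂stdGaussian (EuclideanSpace ℝ (Fin 3))| ≤
      ∫ w, ‖v - w‖ * |u w| ∂stdGaussian (EuclideanSpace ℝ (Fin 3)) := by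
    rw [← Real.norm_eq_abs]
    refine norm_integral_le_of_norm_le (h1.norm.congr (Eventually.of_forall fun w => ?_))
      (Eventually.of_forall fun w => ?_)
    · change ‖‖v - w‖ * u w‖ = ‖v - w‖ * |u w|
      rw [Real.norm_eq_abs, abs_mul, abs_norm]
    · rw [Real.norm_eq_abs, abs_mul, abs_norm]
  refine hb.trans ?_
  have h := integral_mul_abs_le_sqrt_mul_eLpNorm (fun w => norm_nonneg (v - w)) (memLp_two_norm_sub v) hu
  rwa [integral_norm_sub_sq_stdGaussian] at h

/-- The linear shape of `t12_lossTerm_le_of_memLp`: `|K₁u(v)| ≤ π (|v| + 2) ‖u‖_{L²(M)}`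
(`√(|v|² + 3) ≤ |v| + 2`). -/
theorem abs_lossTerm_le_linear_of_memLp {u : EuclideanSpace ℝ (Fin 3) → ℝ}
    (hu : MemLp u 2 (stdGaussian (EuclideanSpace ℝ (Fin 3)))) (v : EuclideanSpace ℝ (Fin 3)) :
    |∫ w, ∫ ω, hardSphereKernel (v, w) ω * u w ∂sphereMeasure ∂stdGaussian (EuclideanSpace ℝ (Fin 3))| ≤
      Real.pi * (‖v‖ + 2) * (eLpNorm u 2 (stdGaussian (EuclideanSpace ℝ (Fin 3)))).toReal := by
  refine (t12_lossTerm_le_of_memLp u hu v).trans (mul_le_mul_of_nonneg_right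
    (mul_le_mul_of_nonneg_left ?_ Real.pi_pos.le) ENNReal.toReal_nonneg)
  rw [Real.sqrt_le_left (by positivity)]
  nlinarith [norm_nonneg v]

/-- **`L²(M)` form of the large-speed asymptotics of the loss term:** for `u ∈ L²(M)` and `v ≠ 0`,
`| K₁u(v) - π (|v| ∫ u dM - |v|⁻¹ ∫ u(w) ⟪w, v⟫ dM(w)) | ≤ π √15 / (2|v|) ‖u‖_{L²(M)}`. [folklore] -/
theorem lossTerm_asymptotics_of_memLp {u : EuclideanSpace ℝ (Fin 3) → ℝ}
    (hu : MemLp u 2 (stdGaussian (EuclideanSpace ℝ (Fin 3)))) {v : EuclideanSpace ℝ (Fin 3)} (hv : v ≠ 0) :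
    |(∫ w, ∫ ω, hardSphereKernel (v, w) ω * u w ∂sphereMeasure ∂stdGaussian (EuclideanSpace ℝ (Fin 3))) -
        Real.pi * (‖v‖ * ∫ w, u w ∂stdGaussian (EuclideanSpace ℝ (Fin 3)) -
          ‖v‖⁻¹ * ∫ w, u w * ⟪w, v⟫_ℝ ∂stdGaussian (EuclideanSpace ℝ (Fin 3)))| ≤
      Real.pi * Real.sqrt 15 / (2 * ‖v‖) * (eLpNorm u 2 (stdGaussian (EuclideanSpace ℝ (Fin 3)))).toReal := by
  have hui : Integrable u (stdGaussian (EuclideanSpace ℝ (Fin 3))) := hu.integrable one_le_two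
  have hu2 := integrable_norm_sq_mul_of_memLp hu
  have hvn : 0 < ‖v‖ := norm_pos_iff.2 hv
  refine (t12_lossTerm_asymptotics u hui hu2 v hv).trans ?_
  calc Real.pi / (2 * ‖v‖) * ∫ w, ‖w‖ ^ 2 * |u w| ∂stdGaussian (EuclideanSpace ℝ (Fin 3))
      ≤ Real.pi / (2 * ‖v‖) * (Real.sqrt 15 * (eLpNorm u 2 (stdGaussian (EuclideanSpace ℝ (Fin 3)))).toReal) :=
        mul_le_mul_of_nonneg_left (integral_norm_sq_mul_abs_le_of_memLp hu) (by positivity)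
    _ = Real.pi * Real.sqrt 15 / (2 * ‖v‖) * (eLpNorm u 2 (stdGaussian (EuclideanSpace ℝ (Fin 3)))).toReal := by
        ring

/-- `L²(M)` form of the decay: for `u ∈ L²(M)` with `∫ u dM = 0`, `∫ u(w) ⟪w, v⟫ dM(w) = 0` and `v ≠ 0`,
`|K₁u(v)| ≤ π √15 / (2|v|) ‖u‖_{L²(M)}`. [folklore] -/
theorem abs_lossTerm_le_of_memLp_of_moments_eq_zero {u : EuclideanSpace ℝ (Fin 3) → ℝ}
    (hu : MemLp u 2 (stdGaussian (EuclideanSpace ℝ (Fin 3)))) {v : EuclideanSpace ℝ (Fin 3)} (hv : v ≠ 0)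
    (h0 : ∫ w, u w ∂stdGaussian (EuclideanSpace ℝ (Fin 3)) = 0)
    (h1 : ∫ w, u w * ⟪w, v⟫_ℝ ∂stdGaussian (EuclideanSpace ℝ (Fin 3)) = 0) :
    |∫ w, ∫ ω, hardSphereKernel (v, w) ω * u w ∂sphereMeasure ∂stdGaussian (EuclideanSpace ℝ (Fin 3))| ≤
      Real.pi * Real.sqrt 15 / (2 * ‖v‖) * (eLpNorm u 2 (stdGaussian (EuclideanSpace ℝ (Fin 3)))).toReal := by
  have h := lossTerm_asymptotics_of_memLp hu hv
  rwa [h0, h1, mul_zero, mul_zero, sub_zero, mul_zero, sub_zero] at h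

/-- `L²(M)` form of the decay for `u ⊥_M` the collision invariants: `u ∈ L²(M)`,
`maxwellianInner u φ = 0` for all `φ ∈ span{1, v_j, |v|²}`, `v ≠ 0` ⟹ `|K₁u(v)| ≤ π √15 / (2|v|) ‖u‖_{L²(M)}`.
[folklore] -/
theorem abs_lossTerm_le_of_memLp_of_orthogonal {u : EuclideanSpace ℝ (Fin 3) → ℝ}
    (hu : MemLp u 2 (stdGaussian (EuclideanSpace ℝ (Fin 3))))
    (horth : ∀ φ ∈ collisionInvariants (EuclideanSpace ℝ (Fin 3)), maxwellianInner u φ = 0)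
    {v : EuclideanSpace ℝ (Fin 3)} (hv : v ≠ 0) :
    |∫ w, ∫ ω, hardSphereKernel (v, w) ω * u w ∂sphereMeasure ∂stdGaussian (EuclideanSpace ℝ (Fin 3))| ≤
      Real.pi * Real.sqrt 15 / (2 * ‖v‖) * (eLpNorm u 2 (stdGaussian (EuclideanSpace ℝ (Fin 3)))).toReal := by
  refine abs_lossTerm_le_of_memLp_of_moments_eq_zero hu hv ?_ ?_
  · have h := horth (fun _ => (1 : ℝ)) (Submodule.subset_span (Or.inl (Or.inl rfl)))
    simpa only [maxwellianInner, mul_one] using h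
  · have h := horth (fun w => ⟪w, v⟫_ℝ) (Submodule.subset_span (Or.inr ⟨v, rfl⟩))
    simpa only [maxwellianInner] using h

end Summit.AtomisticToContinuum.HydrodynamicLimit.Theorems.ClampedCorrectorBirth
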